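import Literature.AlgebraicGeometry.Tropical.TropicalTorusWeilCycles
import HarnessLib

/-!
# Crux `FormalCycleCriterion` (stmt-HodgeConjecture-18571), line `birth` — registered stub 2
# `stub_isCycle_of_incidences`, PROVED

Route `TropicalKugaSatakeCayley` of `HodgeConjecture`. Stub 2 of the registered skeleton
`Cruxes/FormalCycleCriterion/Lines/birth.lean` ("INCIDENCE COARSENING KEEPS `IsCycle`"):

> two `n`-families of framed `2`-cells of `ℝ⁸` with the same framings; if every incidence "ordered
> face `(c, i, π)` is a `Per ℤ⁸`-translate of ordered face `(c', i', π')`" of the first family holds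
> for the corresponding faces of the second family w.r.t. `Per'`, then the first chain being a tropical
> cycle of `ℝ⁸ / Per ℤ⁸` makes the second a tropical cycle of `ℝ⁸ / Per' ℤ⁸`.

Proof (this file, for every coefficient ring `S`, every `g` and every `p`):

1. `TropicalTorus.IsTranslate Per` ("`τ' = τ + Per · k` for one `k ∈ ℤ^g`") is an equivalence
   relation on ordered `p`-tuples of points (`k = 0`, `-k`, `k + k'`).
2. The alternating boundary coefficient `Chain.boundaryCoeff Per Z τ` is the sum, over the finite set
   of FACE INDICES `t = (c, i, π)` whose ordered face `(Z.cell c).face i ∘ π` is a `Per`-translate of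
   `τ`, of the signed framings `sign π · (-1)^i · framing (Z.cell c)` (`boundaryCoeff_eq_sum_filter`).
3. Abstract zero-sum lemma (`sum_eq_zero_of_saturated`): if `R` is a symmetric and transitive
   relation on a finite type, every `R`-class `{t' | R t t'}` has zero `f`-sum, and a finite set `A`
   of `R`-reflexive elements is `R`-saturated, then `∑_{t ∈ A} f t = 0` (induction on `#A`,
   splitting off one class).
4. For the second chain `Z'` and any `τ'`, the index set `A = {t | IsTranslate Per' τ' (face Z' t)}`
   is saturated for `R t t' :⇔ IsTranslate Per (face Z t) (face Z t')` (hypothesis + transitivity),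
   and each `R`-class sums to `boundaryCoeff Per Z (face Z t) = 0` (`IsCycle Per Z`), the framings
   and signs of `Z` and `Z'` being the same. Hence `boundaryCoeff Per' Z' τ' = 0`.

No named fact, no new definition, no sorry. The last theorem has the REGISTERED SIGNATURE VERBATIM
(`S = ℝ`, `g = 8`, `p = 2`); the general form is `isCycle_of_incidences`.

## References

* [Zharkov2020TropicalWeil] I. Zharkov, Tropical abelian varieties, Weil classes and the Hodge
  conjecture, arXiv:2002.02347 (2020), p. 2 (balanced framed polyhedral chains are cycles).
* [MikhalkinZharkov2014Eigenwave] G. Mikhalkin, I. Zharkov, Tropical eigenwave and intermediate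
  Jacobians, LN UMI 15 (2014), Def. 4.2, Prop. 4.3.
-/

noncomputable section

-- `Summit.HodgeConjecture.HodgeConjecture.…` is the mandated namespace (single-conjunct summit).
set_option linter.dupNamespace false

open scoped BigOperators

namespace Summit.HodgeConjecture.HodgeConjecture.Theorems.FormalCycleCriterion

open Literature.AlgebraicGeometry.Tropical
open Literature.AlgebraicGeometry.Tropical.TropicalTorus

/-! ### An abstract zero-sum lemma for saturated finite sets -/

/-- **Sums over saturated sets of a relation with zero-sum classes vanish.** Let `R` be a symmetric
and transitive relation on a finite type `T`, `f : T → M`, and suppose every class `{t' | R t t'}`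
has `∑ f = 0`. Then every finite `A ⊆ T` that is `R`-saturated (`t ∈ A`, `R t t'` ⇒ `t' ∈ A`) and
all of whose members are `R`-reflexive has `∑_{t ∈ A} f t = 0`: split off the class of one member
(contained in `A`, of zero sum) and induct on the cardinality. [folklore] -/
theorem sum_eq_zero_of_saturated {T M : Type*} [Fintype T] [DecidableEq T] [AddCommGroup M]
    (R : T → T → Prop) [DecidableRel R] (hsymm : ∀ {a b}, R a b → R b a)
    (htrans : ∀ {a b c}, R a b → R b c → R a c) (f : T → M)
    (hclass : ∀ t, ∑ t' ∈ Finset.univ.filter (R t), f t' = 0) :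
    ∀ (A : Finset T), (∀ t ∈ A, R t t) → (∀ t ∈ A, ∀ t', R t t' → t' ∈ A) → ∑ t ∈ A, f t = 0 := by
  intro A
  induction A using Finset.strongInduction with
  | H A ih =>
    intro hrefl hsat
    rcases A.eq_empty_or_nonempty with rfl | ⟨t₀, ht₀⟩
    · simp
    · -- the class of `t₀`, a subset of `A` of zero sum
      set Q : Finset T := Finset.univ.filter (R t₀) with hQ
      have hQA : Q ⊆ A := by
        intro t ht
        rw [hQ, Finset.mem_filter] at ht
        exact hsat t₀ ht₀ t ht.2
      have ht₀Q : t₀ ∈ Q := by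
        rw [hQ, Finset.mem_filter]
        exact ⟨Finset.mem_univ _, hrefl t₀ ht₀⟩
      have hsplit : ∑ t ∈ A \ Q, f t + ∑ t ∈ Q, f t = ∑ t ∈ A, f t := Finset.sum_sdiff hQA
      rw [← hsplit, hclass t₀, add_zero]
      -- the rest `A \ Q` is again saturated and strictly smaller
      refine ih (A \ Q) ?_ ?_ ?_
      · exact Finset.sdiff_ssubset hQA ⟨t₀, ht₀Q⟩
      · intro t ht
        exact hrefl t (Finset.mem_sdiff.1 ht).1
      · intro t ht t' htt'
        obtain ⟨htA, htQ⟩ := Finset.mem_sdiff.1 ht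
        refine Finset.mem_sdiff.2 ⟨hsat t htA t' htt', fun ht'Q => htQ ?_⟩
        rw [hQ, Finset.mem_filter] at ht'Q ⊢
        exact ⟨Finset.mem_univ _, htrans ht'Q.2 (hsymm htt')⟩

/-! ### `IsTranslate Per` is an equivalence relation -/

section General

variable {S : Type*} [CommRing S] {g p : ℕ}

/-- Every tuple is a period translate of itself (`k = 0`). [folklore] -/
theorem isTranslate_refl (Per : Matrix (Fin g) (Fin g) S) (τ : Fin p → Fin g → S) :
    IsTranslate Per τ τ :=
  ⟨0, fun j => by
    have : (fun r : Fin g => ((0 : Fin g → ℤ) r : S)) = 0 := by funext r; simp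
    rw [this, Matrix.mulVec_zero, add_zero]⟩

/-- Period translation is symmetric (`k ↦ -k`). [folklore] -/
theorem isTranslate_symm {Per : Matrix (Fin g) (Fin g) S} {τ τ' : Fin p → Fin g → S}
    (h : IsTranslate Per τ τ') : IsTranslate Per τ' τ := by
  obtain ⟨k, hk⟩ := h
  refine ⟨-k, fun j => ?_⟩
  have : (fun r : Fin g => ((-k) r : S)) = -fun r : Fin g => (k r : S) := by
    funext r; simp
  rw [this, Matrix.mulVec_neg, hk j, add_neg_cancel_right]

/-- Period translation is transitive (`k + k'`). [folklore] -/
theorem isTranslate_trans {Per : Matrix (Fin g) (Fin g) S} {τ τ' τ'' : Fin p → Fin g → S}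
    (h : IsTranslate Per τ τ') (h' : IsTranslate Per τ' τ'') : IsTranslate Per τ τ'' := by
  obtain ⟨k, hk⟩ := h
  obtain ⟨k', hk'⟩ := h'
  refine ⟨k + k', fun j => ?_⟩
  have : (fun r : Fin g => ((k + k') r : S)) =
      (fun r : Fin g => (k r : S)) + fun r : Fin g => (k' r : S) := by
    funext r; simp
  rw [this, Matrix.mulVec_add, hk' j, hk j, add_assoc]

/-! ### The boundary coefficient as a sum over face indices -/

variable [Algebra ℚ S]

open Classical in
/-- **The boundary coefficient at `τ` is the sum of the signed framings over the face indices whose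
ordered face is a `Per`-translate of `τ`** (unfolding of `Chain.boundaryCoeff`: the triple sum over
`c, i, π` of `if … then … else 0` is the filtered sum over the product index type
`Fin Z.size × Fin (p + 1) × Perm (Fin p)` of face indices `t = (c, i, π)`). [folklore] -/
theorem boundaryCoeff_eq_sum_filter (Per : Matrix (Fin g) (Fin g) S) (Z : Chain S g p)
    (τ : Fin p → Fin g → S) :
    Z.boundaryCoeff Per τ =
      ∑ t ∈ Finset.univ.filter (fun t : Fin Z.size × Fin (p + 1) × Equiv.Perm (Fin p) =>
          IsTranslate Per τ ((Z.cell t.1).face t.2.1 ∘ t.2.2)),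
        (((Equiv.Perm.sign t.2.2 : ℤˣ) : ℤ) * (-1) ^ (t.2.1 : ℕ) : ℚ) • (Z.cell t.1).framing := by
  rw [Finset.sum_filter]
  simp only [Chain.boundaryCoeff, Fintype.sum_prod_type]

open Classical in
/-- **Incidence coarsening keeps the cycle condition** (general form of the registered stub, any
coefficient ring `S`, any `g`, `p`). Two chains with the same number of cells and the same framings
cell by cell; if whenever two ordered faces of the first are `Per`-translates the corresponding
ordered faces of the second are `Per'`-translates, then `IsCycle Per` for the first implies
`IsCycle Per'` for the second. Proof: for any `τ'`, the set of face indices of `Z'` incident to `τ'`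
(w.r.t. `Per'`) is saturated for the equivalence "faces of `Z` are `Per`-translates", each of whose
classes has signed-framing sum `boundaryCoeff Per Z (face) = 0`. [cite: Zharkov2020TropicalWeil, p. 2] -/
theorem isCycle_of_incidences {n : ℕ} (cell cell' : Fin n → Cell S g p)
    (Per Per' : Matrix (Fin g) (Fin g) S) (hfr : ∀ c, (cell' c).framing = (cell c).framing)
    (hinc : ∀ (c c' : Fin n) (i i' : Fin (p + 1)) (π π' : Equiv.Perm (Fin p)),
      IsTranslate Per ((cell c).face i ∘ π) ((cell c').face i' ∘ π') →
        IsTranslate Per' ((cell' c).face i ∘ π) ((cell' c').face i' ∘ π'))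
    (hZ : (⟨n, cell⟩ : Chain S g p).IsCycle Per) : (⟨n, cell'⟩ : Chain S g p).IsCycle Per' := by
  intro τ'
  rw [boundaryCoeff_eq_sum_filter]
  -- the signed framings of `Z'` are those of `Z`
  simp_rw [show ∀ t : Fin n × Fin (p + 1) × Equiv.Perm (Fin p),
      (((Equiv.Perm.sign t.2.2 : ℤˣ) : ℤ) * (-1) ^ (t.2.1 : ℕ) : ℚ) • (cell' t.1).framing =
        (((Equiv.Perm.sign t.2.2 : ℤˣ) : ℤ) * (-1) ^ (t.2.1 : ℕ) : ℚ) • (cell t.1).framing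
      from fun t => by rw [hfr]]
  -- the relation "faces of `Z` are `Per`-translates" on face indices
  let R : (Fin n × Fin (p + 1) × Equiv.Perm (Fin p)) → (Fin n × Fin (p + 1) × Equiv.Perm (Fin p)) →
      Prop := fun t t' => IsTranslate Per ((cell t.1).face t.2.1 ∘ t.2.2) ((cell t'.1).face t'.2.1 ∘ t'.2.2)
  have hclass : ∀ t : Fin n × Fin (p + 1) × Equiv.Perm (Fin p),
      ∑ t' ∈ Finset.univ.filter (R t),
        (((Equiv.Perm.sign t'.2.2 : ℤˣ) : ℤ) * (-1) ^ (t'.2.1 : ℕ) : ℚ) • (cell t'.1).framing = 0 := by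
    intro t
    have h := hZ ((cell t.1).face t.2.1 ∘ t.2.2)
    rw [boundaryCoeff_eq_sum_filter] at h
    exact h
  refine sum_eq_zero_of_saturated R (fun h => isTranslate_symm h) (fun h h' => isTranslate_trans h h')
    _ hclass _ (fun t _ => isTranslate_refl Per _) ?_
  -- saturation: incidences of `Z` transfer to `Z'` and compose with the incidence to `τ'`
  intro t ht t' htt'
  rw [Finset.mem_filter] at ht ⊢
  exact ⟨Finset.mem_univ _,
    isTranslate_trans ht.2 (hinc t.1 t'.1 t.2.1 t'.2.1 t.2.2 t'.2.2 htt')⟩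

end General

/-- **Registered stub `stub_isCycle_of_incidences` of the line `birth`** (crux `FormalCycleCriterion`,
stmt-HodgeConjecture-18571), verbatim: two `n`-families of framed `2`-cells of `ℝ⁸` with the same
framings; if every `Per`-incidence between ordered faces of the first family is a `Per'`-incidence
between the corresponding ordered faces of the second, then the first chain being a tropical cycle of
`ℝ⁸ / Per ℤ⁸` makes the second a tropical cycle of `ℝ⁸ / Per' ℤ⁸`. The case `S = ℝ`, `g = 8`,
`p = 2` of `isCycle_of_incidences`. [cite: Zharkov2020TropicalWeil, p. 2] -/
theorem stub_isCycle_of_incidences :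
    ∀ (n : ℕ) (cell cell' : Fin n → TropicalTorus.Cell ℝ 8 2) (Per Per' : Matrix (Fin 8) (Fin 8) ℝ),
      (∀ c, (cell' c).framing = (cell c).framing) →
      (∀ (c c' : Fin n) (i i' : Fin 3) (π π' : Equiv.Perm (Fin 2)),
        TropicalTorus.IsTranslate Per ((cell c).face i ∘ π) ((cell c').face i' ∘ π') →
          TropicalTorus.IsTranslate Per' ((cell' c).face i ∘ π) ((cell' c').face i' ∘ π')) →
      (⟨n, cell⟩ : TropicalTorus.Chain ℝ 8 2).IsCycle Per →
        (⟨n, cell'⟩ : TropicalTorus.Chain ℝ 8 2).IsCycle Per' :=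
  fun _ cell cell' Per Per' hfr hinc hZ => isCycle_of_incidences cell cell' Per Per' hfr hinc hZ

end Summit.HodgeConjecture.HodgeConjecture.Theorems.FormalCycleCriterion

end
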